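import Literature.NumberTheory.Automorphic.Liu2021.AppendixC.OmegaHomBlockProjector
import Literature.RingTheory.Idempotents.PositiveInvolutionCentreBlockField
import Literature.AlgebraicGeometry.Motives.AbelianVarietyImageCornerAction
import Literature.RingTheory.SimpleModule.EndomorphismAlgebraFullRankOneProjector
import Literature.AlgebraicGeometry.Motives.AbelianVarietyQuasiIdempotentImageRank
import Literature.RingTheory.CentralSimple.AlbertTypes
import Literature.NumberTheory.Automorphic.Liu2021.Def411AsPrinted
import Literature.AlgebraicGeometry.ComplexMultiplication.EndomorphismAlgebraBlockModule
import Literature.AlgebraicGeometry.ComplexMultiplication.BlockDimensionIdentityOfTateComparison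
import Literature.RingTheory.Idempotents.CentreBlockFieldOfSemisimple
import Literature.RingTheory.Idempotents.PositiveInvolutionCentreBlockTransport
import Literature.NumberTheory.Automorphic.Liu2021.AppendixC.OmegaHomBlockFieldCharacterLevelwise
import Literature.NumberTheory.Automorphic.Liu2021.AppendixC.EtaleH1SemisimpleOfHeckeImage
import HarnessLib

/-!
# [Liu 2021, App. D, proof of Thm. D.6 (1)] the S2′ step «`H¹_B(A_K, ℚ)[π^∞]` has a CM block» — SOCKETS

Summits-side placement (director s216/s216a: the socket predicates are instantiated and consumed here); namespace `Summit.HodgeConjecture.CorCM.HypLiu418.S2prime` over the `Literature…Liu2021.AppendixC` currency.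
Statement SHAPES (`def … : Prop`, predicates of the §4.2 data — no named fact) and their proved JUNCTIONS; no instance, no notation,
no `sorry`.  The ASSEMBLY (the heads concluding `BlockShape'`) is the sequel `S2primeAssembly`.

Setting ([Liu2021] App. C/D, the tree's `Sec42Data` currency): a §4.2 datum `C` (Shimura curves `X_K`, Albanese varieties `A_K = C.A K`,
group `G = 𝔾(𝔸_F^∞)`), a prime `ℓ`, the étale Hecke datum `X` (the `G`-representation `rhoEt` on `H¹_ét(A_∞, ℚ_ℓ) = etaleH1Tower`),
`ι : ℂ ≃ ℚ̄_ℓ`, an abstract `ℂ`-representation `(ρW, W)` of `G` (the theta/Weil carrier `ω`), Hecke translates `T` with isogeny descent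
`hD` (so that the HECKE IMAGE `H_K = T.heckeImage hD K ⊆ End⁰(A_K)` is defined), and the Hom-space
`X.omegaHom ι ρW = Hom_G(ι ∘ ω, ℚ̄_ℓ ⊗ H¹_ét(A_∞))`.

The printed step (p. 140): «… `H¹_B(A_K, ℚ)[π^∞]` is a direct summand … on which the centre of the Hecke algebra acts through a CM
field `M_π` of degree `2 dim`».  The tree proves it in the shape `BlockShape'` (§1) from four SOCKETS (§2) — single-sentence inputs each
with its own producer — and the junctions of §3:
* `SocketKw` — every vector of `W` is fixed by a small level (smoothness, [Liu2021] Def. 4.11);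
* `SocketRosH` — every `H_K` carries a POSITIVE ANTI-INVOLUTION (the Rosati involution of a polarisation of `A_K` restricted to the
  Hecke algebra, whose adjoint of `[KgK]` is `[Kg⁻¹K]`; [Liu2021] (D.3), [MumfordAV1970] §21);
* `SocketMultOne` / `SocketM1` — the multiplicity-one dimension identity on the `ℓ`-adic block of `f ∈ Hom_G(ω, ℚ̄_ℓ ⊗ H¹)`
  ([Liu2021] Prop. D.4 (1)), resp. multiplicity one of `ω` in the Hom-space;
and the auxiliary shapes `SocketRos` (positive anti-involution of `End⁰(A_K)` stabilising `H_K`), `SocketRosZ` (trace-positivity on every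
presentation of a centre block of `H_K`), `SocketBlockFieldPos`, `SocketBlockModule` (★ `exists_ratRep_blockModule_of_numberField`),
`SocketIso` (the label character of the block field, ★ `OmegaHomBlockFieldCharacterLevelwise`), `SocketMO`, `SocketHdim`.
Junction names mentioned in docstrings but not declared here (`socketMO_of_multOne`, `socketHdim_of_MO`, `socketM1_of_pairwise`,
`socketMultOne_of_hss`) are the sequel's `S2primeAssembly` (to be filed).

## References
* [Liu2021] Y. Liu, *Fourier–Jacobi cycles and arithmetic relative trace formula*, Camb. J. Math. 9 (2021), App. D, (D.3) p. 133,
  Prop. D.4 (1), proof of Thm. D.6 (1) p. 140; Def. 4.11.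
* [MumfordAV1970] D. Mumford, *Abelian Varieties*, §21 Thm. 1.
* [MilneCM2006] J. S. Milne, *Complex Multiplication*, Ch. I §1 Prop. 1.36, 1.37 (p. 20).
* [Lam2001FirstCourse] T. Y. Lam, *A First Course in Noncommutative Rings*, §3 Thm. (3.5), §22 Prop. (22.1).
* [Shimura1998] G. Shimura, *Abelian Varieties with Complex Multiplication and Modular Functions*, §5.1 Prop. 5 (p. 38).
-/

set_option autoImplicit false

noncomputable section

open CategoryTheory NumberField Function MulAction
open scoped TensorProduct

namespace Summit.HodgeConjecture.CorCM.HypLiu418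

open Literature.NumberTheory.Automorphic.Liu2021 Literature.NumberTheory.Automorphic.Liu2021.AppendixC

open Literature.AlgebraicGeometry.Motives (AbelianVariety)
open Literature.AlgebraicGeometry.Motives.AbelianVariety (rationalTateModuleMap endAlgebra rationalTateAction image toImage)

variable {F E : Type} [Field F] [NumberField F] [IsTotallyReal F] [Field E] [NumberField E] [Algebra F E]
  [IsTotallyComplex E] [Algebra.IsQuadraticExtension F E]
variable {P5 : PropC5Data F E} {isotropicAt : ℕ → Prop}

namespace S2prime

open Literature.AlgebraicGeometry.Motives
open scoped Matrix

variable (C : Sec42Data P5 isotropicAt) (ℓ : ℕ) [Fact ℓ.Prime] (X : C.EtaleHeckeDatum ℓ)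
  (ι : ℂ ≃+* AlgebraicClosure ℚ_[ℓ]) {W : Type} [AddCommGroup W] [Module ℂ W] (ρW : Representation ℂ C.G W)

/-! ## §1 The conclusion shape `BlockShape'` -/

/-- **The S2′ conclusion shape.**  If the Hom-space `Hom_G(ι ∘ ω, ℚ̄_ℓ ⊗ H¹_ét(A_∞))` has a non-zero value, then at some small level `K` there is an honest endomorphism `u₀` of `A_K` with `u₀² = a₀ u₀` (`a₀ ≠ 0`), `0 < dim (Im u₀)`, injective transport `([·]_K ∘ ᵗV_ℓ(A_K ↠ Im u₀)) ⊗ 1`, and a NUMBER FIELD `R₀` of degree `2 · dim (Im u₀)` acting on `Im u₀` (`j : R₀ →+* End⁰(Im u₀)`) with a ring endomorphism `ρ` of non-negative trace form and a LABEL CHARACTER `τ₀ : R₀ →+* ℂ` whose `(ι ∘ τ₀)`-eigenclasses transport into the span of the values of the Hom-space — the CM block of the printed sentence «the centre of the Hecke algebra acts on the `π^∞`-part through a CM field of degree `2 dim`». [cite: Liu2021, App. D, proof of Thm. D.6 (1) (p. 140)] -/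
def BlockShape' : Prop :=
  (∃ f ∈ X.omegaHom ι ρW, ∃ w : W, f w ≠ 0) →
    ∃ (K : C5.SmallLevel C.S.K₀) (u₀ : C.A K ⟶ C.A K) (a₀ : ℕ), a₀ ≠ 0 ∧ u₀ ≫ u₀ = a₀ • u₀ ∧ 0 < (image u₀).dim ∧
      Function.Injective
        ((C.toTower ℓ K ∘ₗ (rationalTateModuleMap ℓ (toImage u₀)).dualMap).baseChange (AlgebraicClosure ℚ_[ℓ])) ∧
      ∃ (R₀ : Type) (_ : Field R₀) (_ : NumberField R₀) (j : R₀ →+* (image u₀).endAlgebra),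
        Module.finrank ℚ R₀ = 2 * (image u₀).dim ∧
        (∃ ρ : R₀ →+* R₀, ∀ x : R₀, 0 ≤ Algebra.trace ℚ R₀ (x * ρ x)) ∧
        ∃ τ₀ : R₀ →+* ℂ,
          ∀ f₀ : AlgebraicClosure ℚ_[ℓ] ⊗[ℚ_[ℓ]] Module.Dual ℚ_[ℓ] ((image u₀).rationalTateModule ℓ),
            (∀ r : R₀, ((rationalTateAction (image u₀) ℓ (j r)).dualMap).baseChange (AlgebraicClosure ℚ_[ℓ]) f₀ =
                ι (τ₀ r) • f₀) →
              ((C.toTower ℓ K ∘ₗ (rationalTateModuleMap ℓ (toImage u₀)).dualMap).baseChange (AlgebraicClosure ℚ_[ℓ])) f₀ ∈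
                Submodule.span (AlgebraicClosure ℚ_[ℓ]) {y | ∃ f ∈ X.omegaHom ι ρW, ∃ w : W, f w = y}

/-! ## §2 The sockets -/

/-- **Socket (smoothness)**: every vector of `W` is fixed by some small level `K ≤ K₀` ([Liu2021] Def. 4.11: `ω` is a smooth representation). [cite: Liu2021, Def. 4.11] -/
def SocketKw : Prop :=
  ∀ w : W, ∃ K : C5.SmallLevel C.S.K₀, w ∈ ρW.fixedPoints (K.1.1 : Subgroup C.G)

variable {C ρW} in
/-- `SocketKw` from the tree's `Representation.IsSmooth` (every stabiliser is open): the open compact level `Stab(w) ⊓ K₀` fixes `w`. [cite: Liu2021, Def. 4.11] -/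
theorem socketKw_of_isSmooth (hρ : ρW.IsSmooth) : SocketKw C ρW := by
  intro w
  refine ⟨⟨⟨ρW.stabilizerSubgroup w ⊓ C.S.K₀.1, ?_, ?_⟩,
    (inf_le_right : ρW.stabilizerSubgroup w ⊓ C.S.K₀.1 ≤ C.S.K₀.1)⟩, ?_⟩
  · simpa only [Subgroup.coe_inf] using (hρ w).inter C.S.K₀.2.1
  · simpa only [Subgroup.coe_inf] using C.S.K₀.2.2.inter_left (Subgroup.isClosed_of_isOpen _ (hρ w))
  · exact (ρW.mem_fixedPoints_iff_le_stabilizerSubgroup _ w).2 inf_le_left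

variable {C ρW} in
/-- `SocketKw` from Liu's adjective `IsSmoothRep` (★ `Def411AsPrinted`: every vector is fixed by an open subgroup). [cite: Liu2021, Def. 4.11] -/
theorem socketKw_of_isSmoothRep (hρ : Literature.NumberTheory.Automorphic.Liu2021.IsSmoothRep ρW) : SocketKw C ρW := by
  refine socketKw_of_isSmooth fun w => ?_
  obtain ⟨S, hSo, hS⟩ := hρ w
  exact ρW.isSmoothVector_of_le hSo fun g hg => (ρW.mem_stabilizerSubgroup w g).2 (hS g hg)

variable {C ℓ} (T : C.HeckeTranslates) (hD : T.IsogenyDescent)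

/-- **Socket (Rosati on `End⁰(A_K)`)**: at every small level a positive anti-involution of `End⁰_E(A_K)` stabilising the Hecke image `H_K` (the Rosati involution of a polarisation for which `[KgK]† = [Kg⁻¹K]`). [cite: Liu2021, p. 133 (D.3)] [cite: MumfordAV1970, §21 Thm. 1] -/
def SocketRos : Prop :=
  ∀ K : C5.SmallLevel C.S.K₀, ∃ τ : (C.A K).endAlgebra →ₗ[ℚ] (C.A K).endAlgebra,
    Literature.RingTheory.CentralSimple.IsPositiveAntiInvolution (C.A K).endAlgebra τ ∧
      ∀ x ∈ T.heckeImage hD K, τ x ∈ T.heckeImage hD K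

/-- **Socket (Rosati on `H_K`) — the positivity input of record**: at every small level the Hecke image `H_K` (a finite-dimensional `ℚ`-algebra) carries a POSITIVE ANTI-INVOLUTION of its own.  Weaker than `SocketRos` (`socketRosH_of_socketRos` below) and all the assembly consumes: `H_K` is then semisimple (`isSemisimpleRing_heckeImage_of_socketRosH` below) and every centre block inherits trace-positivity (`socketRosZ_of_socketRosH` below). [cite: Liu2021, p. 133 (D.3)] [cite: MumfordAV1970, §21 Thm. 1] [cite: MilneCM2006, Ch. I §1 Prop. 1.36 (p. 20)] -/
def SocketRosH : Prop :=
  ∀ K : C5.SmallLevel C.S.K₀, ∃ τ : ↥(T.heckeImage hD K) →ₗ[ℚ] ↥(T.heckeImage hD K),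
    Literature.RingTheory.CentralSimple.IsPositiveAntiInvolution ↥(T.heckeImage hD K) τ

/-- **Socket (trace-positivity on the centre blocks)**: for every small level `K`, every centrally primitive idempotent `ε ∈ H_K` and EVERY presentation `φ : R₀ ≅ Z(H_K)·ε` of the centre block as a number field (`φ` injective, multiplicative, `φ 1 = ε`, values central in `H_K`, `φ r · ε = φ r`, onto `Z(H_K)·ε`), `R₀` carries a ring endomorphism `ρ` with `0 ≤ Tr_{R₀/ℚ}(x · ρ x)` (the `ρ`-conjunct of `BlockShape'`; with `R₀` totally complex of full degree this makes `R₀` a CM field, Shimura's lemma). [cite: Liu2021, App. D, proof of Thm. D.6 (1) (p. 140)] [cite: Shimura1998, §5.1 Proposition 5 (p. 38)] -/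
def SocketRosZ : Prop :=
  ∀ (K : C5.SmallLevel C.S.K₀) (ε : (C.A K).endAlgebra) (hεH : ε ∈ T.heckeImage hD K)
    (_ : Literature.RingTheory.Idempotents.IsCentrallyPrimitive (⟨ε, hεH⟩ : ↥(T.heckeImage hD K)))
    (R₀ : Type) [Field R₀] [NumberField R₀] (φ : R₀ →ₗ[ℚ] (C.A K).endAlgebra) (_ : Function.Injective φ)
    (_ : ∀ a b, φ (a * b) = φ a * φ b) (_ : φ 1 = ε) (_ : ∀ r, φ r ∈ T.heckeImage hD K)
    (_ : ∀ r, ∀ y ∈ T.heckeImage hD K, φ r * y = y * φ r) (_ : ∀ r, φ r * ε = φ r)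
    (_ : ∀ z ∈ T.heckeImage hD K, (∀ y ∈ T.heckeImage hD K, z * y = y * z) → ∃ r : R₀, φ r = z * ε),
    ∃ ρ : R₀ →+* R₀, ∀ x : R₀, 0 ≤ Algebra.trace ℚ R₀ (x * ρ x)

/-- **The block-field datum** the assembly consumes at a block `ε` of `H_K`: SOME presentation `φ : R₀ ≅ Z(H_K)·ε` (the seven clauses of ★ `exists_centreBlockField_of_isSemisimpleRing`) together with a trace-non-negative ring endomorphism `ρ` of `R₀`.  Fed by levelwise semisimplicity + `SocketRosZ` (`socketBlockFieldPos_of_hss_of_socketRosZ` below), hence by `SocketRosH` (`socketBlockFieldPos_of_socketRosH` below). [cite: Liu2021, App. D, proof of Thm. D.6 (1) (p. 140)] [cite: Lam2001FirstCourse, §3 Thm. (3.5) (pp. 33–35) and §22 Prop. (22.1) (p. 327)] -/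
def SocketBlockFieldPos : Prop :=
  ∀ (K : C5.SmallLevel C.S.K₀) (ε : (C.A K).endAlgebra) (hεH : ε ∈ T.heckeImage hD K)
    (_ : Literature.RingTheory.Idempotents.IsCentrallyPrimitive (⟨ε, hεH⟩ : ↥(T.heckeImage hD K))),
    ∃ (R₀ : Type) (_ : Field R₀) (_ : NumberField R₀) (φ : R₀ →ₗ[ℚ] (C.A K).endAlgebra),
      Function.Injective φ ∧ (∀ a b, φ (a * b) = φ a * φ b) ∧ φ 1 = ε ∧ (∀ r, φ r ∈ T.heckeImage hD K) ∧
      (∀ r, ∀ y ∈ T.heckeImage hD K, φ r * y = y * φ r) ∧ (∀ r, φ r * ε = φ r) ∧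
      (∀ z ∈ T.heckeImage hD K, (∀ y ∈ T.heckeImage hD K, z * y = y * z) → ∃ r : R₀, φ r = z * ε) ∧
      ∃ ρ : R₀ →+* R₀, ∀ x : R₀, 0 ≤ Algebra.trace ℚ R₀ (x * ρ x)

/-- **Socket (the Betti block module)** — the statement of ★ `exists_ratRep_blockModule_of_numberField` at `B := A_K`, `H := H_K`: a faithful rational representation `ψ` of `End⁰(A_K)` of degree `2 dim A_K` with its `ℓ'`-adic comparisons, and the block module `V := range (ψ ε)` with its `R₀`-structure and `H_K`-action `act`, the kernel clause `act h = 0 ↔ ε h = 0`, and the degree identity `2 dim (Im u) = dim_ℚ range (act h)` for honest quasi-idempotents `u` realising `a • h`.  A THEOREM (`socketBlockModule_holds` below); kept as a socket so that the assembly reads one uniform interface. [cite: Liu2021, App. D, proof of Thm. D.6 (1) (p. 140)] -/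
def SocketBlockModule : Prop :=
  ∀ (K : C5.SmallLevel C.S.K₀) (ε : (C.A K).endAlgebra) (_ : ε ∈ T.heckeImage hD K) (_ : IsIdempotentElem ε) (_ : ε ≠ 0)
    (_ : ∀ h ∈ T.heckeImage hD K, ε * h = h * ε)
    (R₀ : Type) [Field R₀] [NumberField R₀] (φ : R₀ →ₗ[ℚ] (C.A K).endAlgebra)
    (_ : ∀ a b, φ (a * b) = φ a * φ b) (_ : φ 1 = ε) (hφH : ∀ r, φ r ∈ T.heckeImage hD K)
    (_ : ∀ r, ∀ h ∈ T.heckeImage hD K, φ r * h = h * φ r),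
    ∃ (ι : Type) (_ : Fintype ι) (_ : DecidableEq ι) (ψ : (C.A K).endAlgebra →ₐ[ℚ] Matrix ι ι ℚ),
      Function.Injective ψ ∧ Fintype.card ι = 2 * (C.A K).dim ∧
      (∀ (ℓ' : ℕ) [Fact ℓ'.Prime], ∃ c : (ι → ℚ_[ℓ']) ≃ₗ[ℚ_[ℓ']] (C.A K).rationalTateModule ℓ', ∀ x,
          (c : _ →ₗ[ℚ_[ℓ']] _) ∘ₗ Matrix.mulVecLin ((ψ x).map (algebraMap ℚ ℚ_[ℓ'])) =
            (rationalTateAction (C.A K) ℓ' x) ∘ₗ (c : _ →ₗ[ℚ_[ℓ']] _)) ∧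
      ∃ (_ : Module R₀ ↥(LinearMap.range (Matrix.mulVecLin (ψ ε))))
        (_ : IsScalarTower ℚ R₀ ↥(LinearMap.range (Matrix.mulVecLin (ψ ε))))
        (_ : Module.Finite R₀ ↥(LinearMap.range (Matrix.mulVecLin (ψ ε))))
        (_ : Nontrivial ↥(LinearMap.range (Matrix.mulVecLin (ψ ε))))
        (act : ↥(T.heckeImage hD K) →ₐ[ℚ] Module.End ℚ ↥(LinearMap.range (Matrix.mulVecLin (ψ ε)))),
        (∀ h v, ((act h v : ↥(LinearMap.range (Matrix.mulVecLin (ψ ε)))) : ι → ℚ) = Matrix.mulVec (ψ h) (v : ι → ℚ)) ∧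
        (∀ (r : R₀) v, ((r • v : ↥(LinearMap.range (Matrix.mulVecLin (ψ ε)))) : ι → ℚ) = Matrix.mulVec (ψ (φ r)) (v : ι → ℚ)) ∧
        (∀ h (r : R₀) v, act h (r • v) = r • act h v) ∧
        (∀ (r : R₀) v, act ⟨φ r, hφH r⟩ v = r • v) ∧
        (∀ h : ↥(T.heckeImage hD K), act h = 0 ↔ ε * (h : (C.A K).endAlgebra) = 0) ∧
        ∀ (h : ↥(T.heckeImage hD K)) (u : C.A K ⟶ C.A K) (a : ℕ), u ≫ u = a • u → a ≠ 0 →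
          ε * (h : (C.A K).endAlgebra) = h → endAlgebra.of (C.A K) u = (a : ℚ) • (h : (C.A K).endAlgebra) →
            2 * (image u).dim = Module.finrank ℚ ↥(LinearMap.range (act h))

/-- `SocketBlockModule` holds: ★ `exists_ratRep_blockModule_of_numberField` verbatim. [cite: Liu2021, App. D, proof of Thm. D.6 (1) (p. 140)] -/
theorem socketBlockModule_holds : SocketBlockModule T hD :=
  fun K _ hεH hε hε0 hεc _ _ _ φ hφmul hφ1 hφH hφc =>
    Literature.AlgebraicGeometry.ComplexMultiplication.exists_ratRep_blockModule_of_numberField (C.A K) (T.heckeImage hD K) hεH hε hε0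
      hεc φ hφmul hφ1 hφH hφc

variable (ℓ)

/-- **Socket (the label character)**: for the block `ε ∈ H_K` of a non-zero `f ∈ Hom_G(ι ∘ ω, ℚ̄_ℓ ⊗ H¹_ét)` at level `K` (selector identity: `ε` acts as `1` on the level-`K` classes under `f(ω^K)`) and a presentation `φ : R₀ ≅ Z(H_K)·ε`, there is a ring homomorphism `τ₀ : R₀ →+* ℂ` such that every level-`K` class on which each `ᵗV_ℓ(φ r) ⊗ 1` acts as `ι (τ₀ r)` maps under `[·]_K ⊗ 1` into the span of the values of the Hom-space.  A THEOREM of levelwise semisimplicity (`socketIso_of_hss` below, ★ `OmegaHomBlockFieldCharacterLevelwise`). [cite: Liu2021, App. D, proof of Thm. D.6 (1) (p. 140)] [cite: Liu2021, p. 133 (D.3)] -/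
def SocketIso : Prop :=
  ∀ (K : C5.SmallLevel C.S.K₀)
    (f : W →ₛₗ[(ι : ℂ →+* AlgebraicClosure ℚ_[ℓ])] AlgebraicClosure ℚ_[ℓ] ⊗[ℚ_[ℓ]] C.etaleH1Tower ℓ)
    (_ : f ∈ X.omegaHom ι ρW) (_ : ∃ w ∈ ρW.fixedPoints (K.1.1 : Subgroup C.G), f w ≠ 0)
    (ε : (C.A K).endAlgebra) (_ : ε ∈ T.heckeImage hD K)
    (_ : ∀ w ∈ ρW.fixedPoints (K.1.1 : Subgroup C.G), ∀ x : (AlgebraicClosure ℚ_[ℓ]) ⊗[ℚ_[ℓ]] C.etaleH1 ℓ K,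
        (C.toTower ℓ K).baseChange (AlgebraicClosure ℚ_[ℓ]) x = f w →
          (C.toTower ℓ K).baseChange (AlgebraicClosure ℚ_[ℓ])
            (((rationalTateAction (C.A K) ℓ ε).dualMap).baseChange (AlgebraicClosure ℚ_[ℓ]) x) = f w)
    (R₀ : Type) [Field R₀] [NumberField R₀] (φ : R₀ →ₗ[ℚ] (C.A K).endAlgebra) (_ : Function.Injective φ)
    (_ : ∀ a b, φ (a * b) = φ a * φ b) (_ : φ 1 = ε) (_ : ∀ r, φ r ∈ T.heckeImage hD K)
    (_ : ∀ r, ∀ h ∈ T.heckeImage hD K, φ r * h = h * φ r)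
    (_ : ∀ z ∈ T.heckeImage hD K, (∀ y ∈ T.heckeImage hD K, z * y = y * z) → ∃ r : R₀, φ r = z * ε),
    ∃ τ₀ : R₀ →+* ℂ, ∀ m : AlgebraicClosure ℚ_[ℓ] ⊗[ℚ_[ℓ]] C.etaleH1 ℓ K,
      (∀ r : R₀, ((rationalTateAction (C.A K) ℓ (φ r)).dualMap).baseChange (AlgebraicClosure ℚ_[ℓ]) m = ι (τ₀ r) • m) →
        (C.toTower ℓ K).baseChange (AlgebraicClosure ℚ_[ℓ]) m ∈
          Submodule.span (AlgebraicClosure ℚ_[ℓ]) {y | ∃ f ∈ X.omegaHom ι ρW, ∃ w : W, f w = y}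

/-- **Socket (the multiplicity-one dimension identity on the `ℓ`-adic block)**: for the block `ε` of `f` at level `K` (selector identity, `ε` centrally primitive in `H_K`), some model `Wε ↪ ℚ̄_ℓ ⊗ H¹_ét(A_K)` of `range (ᵗV_ℓ ε ⊗ 1)` with the induced action `act′` of `H_K` satisfies `dim Z(ℚ̄_ℓ⟨act′⟩) · dim ℚ̄_ℓ⟨act′⟩ = (dim Wε)²` — the `hMO` hypothesis of ★ `finrank_mul_finrank_range_eq_sq_of_exists_block`, which encodes that every simple constituent of the block occurs ONCE ([Liu2021] Prop. D.4 (1)).  Fed by `SocketMultOne` + `SocketM1` (junction `socketMO_of_multOne` in the sequel `S2primeAssembly`, to be filed). [cite: Liu2021, App. D, Prop. D.4 (1)] [cite: Liu2021, App. D, proof of Thm. D.6 (1) (p. 140)] -/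
def SocketMO : Prop :=
  ∀ (K : C5.SmallLevel C.S.K₀)
    (f : W →ₛₗ[(ι : ℂ →+* AlgebraicClosure ℚ_[ℓ])] AlgebraicClosure ℚ_[ℓ] ⊗[ℚ_[ℓ]] C.etaleH1Tower ℓ)
    (_ : f ∈ X.omegaHom ι ρW) (_ : ∃ w ∈ ρW.fixedPoints (K.1.1 : Subgroup C.G), f w ≠ 0)
    (ε : (C.A K).endAlgebra) (hεH : ε ∈ T.heckeImage hD K)
    (_ : Literature.RingTheory.Idempotents.IsCentrallyPrimitive (⟨ε, hεH⟩ : ↥(T.heckeImage hD K)))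
    (_ : ∀ w ∈ ρW.fixedPoints (K.1.1 : Subgroup C.G), ∀ x : (AlgebraicClosure ℚ_[ℓ]) ⊗[ℚ_[ℓ]] C.etaleH1 ℓ K,
        (C.toTower ℓ K).baseChange (AlgebraicClosure ℚ_[ℓ]) x = f w →
          (C.toTower ℓ K).baseChange (AlgebraicClosure ℚ_[ℓ])
            (((rationalTateAction (C.A K) ℓ ε).dualMap).baseChange (AlgebraicClosure ℚ_[ℓ]) x) = f w),
    ∃ (Wε : Type) (_ : AddCommGroup Wε) (_ : Module (AlgebraicClosure ℚ_[ℓ]) Wε) (_ : Module ℚ Wε)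
      (_ : IsScalarTower ℚ (AlgebraicClosure ℚ_[ℓ]) Wε)
      (iW : Wε →ₗ[AlgebraicClosure ℚ_[ℓ]] AlgebraicClosure ℚ_[ℓ] ⊗[ℚ_[ℓ]] Module.Dual ℚ_[ℓ] ((C.A K).rationalTateModule ℓ))
      (act' : ↥(T.heckeImage hD K) → Module.End (AlgebraicClosure ℚ_[ℓ]) Wε),
      Function.Injective iW ∧
      LinearMap.range iW =
        LinearMap.range (((rationalTateAction (C.A K) ℓ ε : Module.End ℚ_[ℓ] ((C.A K).rationalTateModule ℓ)).dualMap).baseChange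
          (AlgebraicClosure ℚ_[ℓ])) ∧
      (∀ (h : ↥(T.heckeImage hD K)) (w : Wε), iW (act' h w) =
        ((rationalTateAction (C.A K) ℓ (h : (C.A K).endAlgebra) :
            Module.End ℚ_[ℓ] ((C.A K).rationalTateModule ℓ)).dualMap).baseChange (AlgebraicClosure ℚ_[ℓ]) (iW w)) ∧
      Module.finrank (AlgebraicClosure ℚ_[ℓ]) ↥(Algebra.adjoin (AlgebraicClosure ℚ_[ℓ]) (Set.range act') ⊓
          Subalgebra.centralizer (AlgebraicClosure ℚ_[ℓ])
            (Algebra.adjoin (AlgebraicClosure ℚ_[ℓ]) (Set.range act') : Set (Module.End (AlgebraicClosure ℚ_[ℓ]) Wε))) *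
        Module.finrank (AlgebraicClosure ℚ_[ℓ]) ↥(Algebra.adjoin (AlgebraicClosure ℚ_[ℓ]) (Set.range act')) =
      Module.finrank (AlgebraicClosure ℚ_[ℓ]) Wε ^ 2

/-- **Socket (the degree identity on the Betti block module)**: for the block `ε` of `f` at level `K`, a presentation `φ : R₀ ≅ Z(H_K)·ε` and the block module `(ψ, V := range (ψ ε), act)` of `SocketBlockModule`: `[R₀:ℚ] · dim_ℚ act(H_K) = (dim_ℚ V)²`.  A consequence of `SocketMO` (junction `socketHdim_of_MO` in the sequel `S2primeAssembly`, to be filed; ★ `finrank_mul_finrank_range_eq_sq_of_exists_block`). [cite: Liu2021, App. D, proof of Thm. D.6 (1) (p. 140)] -/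
def SocketHdim : Prop :=
  ∀ (K : C5.SmallLevel C.S.K₀)
    (f : W →ₛₗ[(ι : ℂ →+* AlgebraicClosure ℚ_[ℓ])] AlgebraicClosure ℚ_[ℓ] ⊗[ℚ_[ℓ]] C.etaleH1Tower ℓ)
    (_ : f ∈ X.omegaHom ι ρW) (_ : ∃ w ∈ ρW.fixedPoints (K.1.1 : Subgroup C.G), f w ≠ 0)
    (ε : (C.A K).endAlgebra) (hεH : ε ∈ T.heckeImage hD K)
    (_ : Literature.RingTheory.Idempotents.IsCentrallyPrimitive (⟨ε, hεH⟩ : ↥(T.heckeImage hD K)))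
    (_ : ∀ w ∈ ρW.fixedPoints (K.1.1 : Subgroup C.G), ∀ x : (AlgebraicClosure ℚ_[ℓ]) ⊗[ℚ_[ℓ]] C.etaleH1 ℓ K,
        (C.toTower ℓ K).baseChange (AlgebraicClosure ℚ_[ℓ]) x = f w →
          (C.toTower ℓ K).baseChange (AlgebraicClosure ℚ_[ℓ])
            (((rationalTateAction (C.A K) ℓ ε).dualMap).baseChange (AlgebraicClosure ℚ_[ℓ]) x) = f w)
    (_ : IsIdempotentElem ε) (_ : ε ≠ 0) (_ : ∀ h ∈ T.heckeImage hD K, ε * h = h * ε)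
    (R₀ : Type) [Field R₀] [NumberField R₀] (φ : R₀ →ₗ[ℚ] (C.A K).endAlgebra) (_ : Function.Injective φ)
    (_ : ∀ a b, φ (a * b) = φ a * φ b) (_ : φ 1 = ε) (hφH : ∀ r, φ r ∈ T.heckeImage hD K)
    (_ : ∀ r, ∀ h ∈ T.heckeImage hD K, φ r * h = h * φ r)
    (_ : ∀ z ∈ T.heckeImage hD K, (∀ y ∈ T.heckeImage hD K, z * y = y * z) → ∃ r : R₀, φ r = z * ε)
    (κ : Type) [Fintype κ] [DecidableEq κ] (ψ : (C.A K).endAlgebra →ₐ[ℚ] Matrix κ κ ℚ) (_ : Function.Injective ψ)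
    (_ : ∀ (ℓ' : ℕ) [Fact ℓ'.Prime], ∃ c : (κ → ℚ_[ℓ']) ≃ₗ[ℚ_[ℓ']] (C.A K).rationalTateModule ℓ', ∀ x,
          (c : _ →ₗ[ℚ_[ℓ']] _) ∘ₗ Matrix.mulVecLin ((ψ x).map (algebraMap ℚ ℚ_[ℓ'])) =
            (rationalTateAction (C.A K) ℓ' x) ∘ₗ (c : _ →ₗ[ℚ_[ℓ']] _))
    (act : ↥(T.heckeImage hD K) →ₐ[ℚ] Module.End ℚ ↥(LinearMap.range (Matrix.mulVecLin (ψ ε))))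
    (_ : ∀ h v, ((act h v : ↥(LinearMap.range (Matrix.mulVecLin (ψ ε)))) : κ → ℚ) = Matrix.mulVec (ψ h) (v : κ → ℚ))
    (_ : ∀ h : ↥(T.heckeImage hD K), act h = 0 ↔ ε * (h : (C.A K).endAlgebra) = 0),
    Module.finrank ℚ R₀ * Module.finrank ℚ ↥act.range =
      Module.finrank ℚ ↥(LinearMap.range (Matrix.mulVecLin (ψ ε))) ^ 2

/-- **Socket (the (MO) producer's statement)** — ★ `Sec42Data.HeckeTranslates.exists_block_multOne` as a predicate of the data: for the block `ε` of `f` at level `K` (selector identity, `ε` centrally primitive and commuting with `H_K`), any faithful rational representation `ψ` with its `ℓ`-adic comparison `c`, and MULTIPLICITY ONE of `ω` in the Hom-space (`hm1`), the `SocketMO` ∃-form holds.  Discharged from levelwise semisimplicity in the sequel `S2primeAssembly` (to be filed: `socketMultOne_of_hss`, one application of ★ `Sec42Data.HeckeTranslates.exists_block_multOne`). [cite: Liu2021, App. D, Prop. D.4 (1)] [cite: Liu2021, App. D, proof of Thm. D.6 (1) (p. 140)] -/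
def SocketMultOne : Prop :=
  ∀ (K : C5.SmallLevel C.S.K₀)
    (f : W →ₛₗ[(ι : ℂ →+* AlgebraicClosure ℚ_[ℓ])] AlgebraicClosure ℚ_[ℓ] ⊗[ℚ_[ℓ]] C.etaleH1Tower ℓ)
    (_ : f ∈ X.omegaHom ι ρW) (_ : ∃ w ∈ ρW.fixedPoints (K.1.1 : Subgroup C.G), f w ≠ 0)
    (ε : (C.A K).endAlgebra) (hεH : ε ∈ T.heckeImage hD K)
    (_ : Literature.RingTheory.Idempotents.IsCentrallyPrimitive (⟨ε, hεH⟩ : ↥(T.heckeImage hD K)))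
    (_ : ∀ h ∈ T.heckeImage hD K, ε * h = h * ε)
    (_ : ∀ w ∈ ρW.fixedPoints (K.1.1 : Subgroup C.G), ∀ x : (AlgebraicClosure ℚ_[ℓ]) ⊗[ℚ_[ℓ]] C.etaleH1 ℓ K,
        (C.toTower ℓ K).baseChange (AlgebraicClosure ℚ_[ℓ]) x = f w →
          (C.toTower ℓ K).baseChange (AlgebraicClosure ℚ_[ℓ])
            (((rationalTateAction (C.A K) ℓ ε).dualMap).baseChange (AlgebraicClosure ℚ_[ℓ]) x) = f w)
    (κ : Type) [Fintype κ] [DecidableEq κ] (ψ : (C.A K).endAlgebra →ₐ[ℚ] Matrix κ κ ℚ)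
    (c : (κ → ℚ_[ℓ]) ≃ₗ[ℚ_[ℓ]] (C.A K).rationalTateModule ℓ)
    (_ : ∀ x : (C.A K).endAlgebra,
      (c : (κ → ℚ_[ℓ]) →ₗ[ℚ_[ℓ]] (C.A K).rationalTateModule ℓ) ∘ₗ Matrix.mulVecLin ((ψ x).map (algebraMap ℚ ℚ_[ℓ])) =
        (rationalTateAction (C.A K) ℓ x : Module.End ℚ_[ℓ] ((C.A K).rationalTateModule ℓ)) ∘ₗ
          (c : (κ → ℚ_[ℓ]) →ₗ[ℚ_[ℓ]] (C.A K).rationalTateModule ℓ))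
    (_ : ∀ f₁ ∈ X.omegaHom ι ρW, ∃ a : AlgebraicClosure ℚ_[ℓ], f₁ = a • f),
    ∃ (Wε : Type) (_ : AddCommGroup Wε) (_ : Module (AlgebraicClosure ℚ_[ℓ]) Wε) (_ : Module ℚ Wε)
      (_ : IsScalarTower ℚ (AlgebraicClosure ℚ_[ℓ]) Wε)
      (iW : Wε →ₗ[AlgebraicClosure ℚ_[ℓ]] AlgebraicClosure ℚ_[ℓ] ⊗[ℚ_[ℓ]] Module.Dual ℚ_[ℓ] ((C.A K).rationalTateModule ℓ))
      (act' : ↥(T.heckeImage hD K) → Module.End (AlgebraicClosure ℚ_[ℓ]) Wε),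
      Function.Injective iW ∧
      LinearMap.range iW =
        LinearMap.range (((rationalTateAction (C.A K) ℓ ε : Module.End ℚ_[ℓ] ((C.A K).rationalTateModule ℓ)).dualMap).baseChange
          (AlgebraicClosure ℚ_[ℓ])) ∧
      (∀ (h : ↥(T.heckeImage hD K)) (w : Wε), iW (act' h w) =
        ((rationalTateAction (C.A K) ℓ (h : (C.A K).endAlgebra) :
            Module.End ℚ_[ℓ] ((C.A K).rationalTateModule ℓ)).dualMap).baseChange (AlgebraicClosure ℚ_[ℓ]) (iW w)) ∧
      Module.finrank (AlgebraicClosure ℚ_[ℓ]) ↥(Algebra.adjoin (AlgebraicClosure ℚ_[ℓ]) (Set.range act') ⊓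
          Subalgebra.centralizer (AlgebraicClosure ℚ_[ℓ])
            (Algebra.adjoin (AlgebraicClosure ℚ_[ℓ]) (Set.range act') : Set (Module.End (AlgebraicClosure ℚ_[ℓ]) Wε))) *
        Module.finrank (AlgebraicClosure ℚ_[ℓ]) ↥(Algebra.adjoin (AlgebraicClosure ℚ_[ℓ]) (Set.range act')) =
      Module.finrank (AlgebraicClosure ℚ_[ℓ]) Wε ^ 2

/-- **Socket (multiplicity one)** — [Liu2021] Prop. D.4 (1) in the producer's form: every element of `Hom_G(ι ∘ ω, ℚ̄_ℓ ⊗ H¹_ét(A_∞))` is a multiple of any element with a non-zero value. [cite: Liu2021, App. D, Prop. D.4 (1)] -/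
def SocketM1 : Prop :=
  ∀ f ∈ X.omegaHom ι ρW, (∃ w : W, f w ≠ 0) → ∀ f₁ ∈ X.omegaHom ι ρW, ∃ a : AlgebraicClosure ℚ_[ℓ], f₁ = a • f

/-! ## §3 Junctions -/

/-- **Junction `SocketRos → SocketRosH`**: a positive anti-involution of `End⁰(A_K)` stabilising `H_K` restricts to a positive anti-involution of `H_K` (★ `IsPositiveAntiInvolution.exists_of_injective` along `H_K.val`, Milne's Prop. 1.37: the faithful module `End⁰(A_K)` carries the positive form). [cite: MilneCM2006, Ch. I §1 Prop. 1.37 (p. 20)] -/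
theorem socketRosH_of_socketRos (hRos : SocketRos T hD) : SocketRosH T hD := by
  intro K
  obtain ⟨τ, hτ, hτH⟩ := hRos K
  haveI : Module.Finite ℚ (C.A K).endAlgebra := endAlgebra.instModuleFinite (C.A K)
  obtain ⟨τ', hτ', -⟩ := hτ.exists_of_injective (T.heckeImage hD K).val Subtype.val_injective
    (fun b => ⟨⟨τ b, hτH b b.2⟩, rfl⟩)
  exact ⟨τ', hτ'⟩

/-- `H_K` is a semisimple ring at every small level, granted `SocketRosH` (Milne's Prop. 1.36 / Mumford §21 Thm. 1: a finite-dimensional `ℚ`-algebra with a positive anti-involution is semisimple, ★ `IsPositiveAntiInvolution.isSemisimpleRing`). [cite: MilneCM2006, Ch. I §1 Prop. 1.36 (p. 20)] [cite: MumfordAV1970, §21 Thm. 1] -/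
theorem isSemisimpleRing_heckeImage_of_socketRosH (hRosH : SocketRosH T hD) (K : C5.SmallLevel C.S.K₀) :
    IsSemisimpleRing ↥(T.heckeImage hD K) := by
  obtain ⟨τ, hτ⟩ := hRosH K
  haveI : Module.Finite ℚ ↥(T.heckeImage hD K) := T.module_finite_heckeImage hD K
  exact hτ.isSemisimpleRing

/-- **Junction `SocketRosH → SocketRosZ`**: a positive anti-involution `τ` of `H_K` induces, on EVERY presentation `φ : R₀ ≅ Z(H_K)·ε` of every centre block, a ring endomorphism with non-negative trace form — ★ `exists_ringHom_trace_mul_nonneg_of_isPositiveAntiInvolution_of_block` applied inside `H_K` (`D := H_K`, `H := ⊤`, the presentation re-based to `H_K`-valued maps; `τ ε = ε` by positivity and `ρ := φ⁻¹ ∘ τ ∘ φ`). [cite: Liu2021, App. D, proof of Thm. D.6 (1) (p. 140)] [cite: Shimura1998, §5.1 Proposition 5 (p. 38)] [cite: MilneCM2006, Ch. I §1 Prop. 1.37 (p. 20)] -/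
theorem socketRosZ_of_socketRosH (hRosH : SocketRosH T hD) : SocketRosZ T hD := by
  intro K ε hεH hεcp R₀ _ _ φ hφinj hφmul _ hφH hφc hφε hφsurj
  obtain ⟨τ, hτ⟩ := hRosH K
  haveI : Module.Finite ℚ ↥(T.heckeImage hD K) := T.module_finite_heckeImage hD K
  obtain ⟨φ', hφ'⟩ : ∃ φ' : R₀ →ₗ[ℚ] ↥(T.heckeImage hD K), ∀ r, (φ' r : (C.A K).endAlgebra) = φ r :=
    ⟨{ toFun := fun r => ⟨φ r, hφH r⟩
       map_add' := fun a b => Subtype.ext (map_add φ a b)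
       map_smul' := fun q a => Subtype.ext (map_smul φ q a) }, fun _ => rfl⟩
  have hmem : (⟨ε, hεH⟩ : ↥(T.heckeImage hD K)) ∈ (⊤ : Subalgebra ℚ ↥(T.heckeImage hD K)) := Algebra.mem_top
  have hε' : Literature.RingTheory.Idempotents.IsCentrallyPrimitive
      (⟨⟨ε, hεH⟩, hmem⟩ : ↥(⊤ : Subalgebra ℚ ↥(T.heckeImage hD K))) := by
    have h := hεcp.map (Subalgebra.topEquiv (R := ℚ) (A := ↥(T.heckeImage hD K))).symm.toRingEquiv
    have heq : (Subalgebra.topEquiv (R := ℚ) (A := ↥(T.heckeImage hD K))).symm.toRingEquiv ⟨ε, hεH⟩ = ⟨⟨ε, hεH⟩, hmem⟩ :=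
      Subtype.ext (by simp)
    rw [heq] at h
    exact h
  have hφinj' : Function.Injective φ' := fun a b h => hφinj (by rw [← hφ' a, ← hφ' b, h])
  have hφmul' : ∀ a b, φ' (a * b) = φ' a * φ' b := fun a b => Subtype.ext (by
    rw [Subalgebra.coe_mul, hφ', hφ', hφ', hφmul])
  have hφH' : ∀ r, φ' r ∈ (⊤ : Subalgebra ℚ ↥(T.heckeImage hD K)) := fun _ => Algebra.mem_top
  have hφc' : ∀ r, ∀ y ∈ (⊤ : Subalgebra ℚ ↥(T.heckeImage hD K)), φ' r * y = y * φ' r := fun r y _ =>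
    Subtype.ext (by rw [Subalgebra.coe_mul, Subalgebra.coe_mul, hφ', hφc r y y.2])
  have hφε' : ∀ r, φ' r * ⟨ε, hεH⟩ = φ' r := fun r => Subtype.ext (by rw [Subalgebra.coe_mul, hφ', hφε])
  have hφsurj' : ∀ z ∈ (⊤ : Subalgebra ℚ ↥(T.heckeImage hD K)),
      (∀ y ∈ (⊤ : Subalgebra ℚ ↥(T.heckeImage hD K)), z * y = y * z) → ∃ r : R₀, φ' r = z * ⟨ε, hεH⟩ := by
    intro z _ hz
    obtain ⟨r, hr⟩ := hφsurj z z.2 (fun y hy => congrArg Subtype.val (hz ⟨y, hy⟩ Algebra.mem_top))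
    exact ⟨r, Subtype.ext (by rw [hφ', hr, Subalgebra.coe_mul])⟩
  exact Literature.RingTheory.Idempotents.exists_ringHom_trace_mul_nonneg_of_isPositiveAntiInvolution_of_block hτ ⊤
    (fun _ _ => Algebra.mem_top) hmem hε' φ' hφinj' hφmul' hφH' hφc' hφε' hφsurj'

/-- `SocketBlockFieldPos` from LEVELWISE SEMISIMPLICITY of the Hecke images and `SocketRosZ`: ★ `exists_centreBlockField_of_isSemisimpleRing` presents the centre block of the semisimple `H_K` as a number field (its centre is reduced, Wedderburn–Artin), and `SocketRosZ` supplies `ρ` on that presentation. [cite: Lam2001FirstCourse, §3 Thm. (3.5) (pp. 33–35) and §22 Prop. (22.1) (p. 327)] [cite: Liu2021, App. D, proof of Thm. D.6 (1) (p. 140)] -/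
theorem socketBlockFieldPos_of_hss_of_socketRosZ (hH : ∀ K : C5.SmallLevel C.S.K₀, IsSemisimpleRing ↥(T.heckeImage hD K))
    (hRosZ : SocketRosZ T hD) : SocketBlockFieldPos T hD := by
  intro K ε hεH hεcp
  haveI := hH K
  obtain ⟨R₀, hF, hNF, φ, hφinj, hφmul, hφ1, hφH, hφc, hφε, hφsurj⟩ :=
    Literature.RingTheory.Idempotents.exists_centreBlockField_of_isSemisimpleRing (T.heckeImage hD K) hεH hεcp
  obtain ⟨ρ, hρ⟩ := hRosZ K ε hεH hεcp R₀ φ hφinj hφmul hφ1 hφH hφc hφε hφsurj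
  exact ⟨R₀, hF, hNF, φ, hφinj, hφmul, hφ1, hφH, hφc, hφε, hφsurj, ρ, hρ⟩

/-- `SocketBlockFieldPos` from `SocketRosH` (semisimplicity and positivity both from the involution on `H_K`). [cite: Liu2021, App. D, proof of Thm. D.6 (1) (p. 140)] [cite: MumfordAV1970, §21 Thm. 1] -/
theorem socketBlockFieldPos_of_socketRosH (hRosH : SocketRosH T hD) : SocketBlockFieldPos T hD :=
  socketBlockFieldPos_of_hss_of_socketRosZ T hD (isSemisimpleRing_heckeImage_of_socketRosH T hD hRosH)
    (socketRosZ_of_socketRosH T hD hRosH)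

/-- **`SocketIso` from levelwise semisimplicity alone** — ★ `exists_ringHom_forall_eigen_toTower_baseChange_mem_span_of_isSemisimpleRing_heckeImage` (the label character and «its eigenclasses are block values», [Liu2021] p. 140 with (D.3)); the base-changed tower representation `σ = 1 ⊗ rhoEt` demanded by that theorem is CONSTRUCTED as `Module.End.baseChangeHom ∘ rhoEt`. [cite: Liu2021, App. D, proof of Thm. D.6 (1) (p. 140)] [cite: Liu2021, p. 133 (D.3)] -/
theorem socketIso_of_hss [ρW.IsIrreducible]
    (hI : ∀ ⦃K K' : C5.SmallLevel C.S.K₀⦄ (g : K' ⟶ K), Function.Injective (rationalTateModuleMap ℓ (C.Atr g)).dualMap)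
    (hX : X.rhoEt = T.etHeckeRep ℓ) (hH : ∀ K : C5.SmallLevel C.S.K₀, IsSemisimpleRing ↥(T.heckeImage hD K)) :
    SocketIso ℓ X ι ρW T hD := by
  obtain ⟨σ, hσ⟩ : ∃ σ : Representation (AlgebraicClosure ℚ_[ℓ]) C.G (AlgebraicClosure ℚ_[ℓ] ⊗[ℚ_[ℓ]] C.etaleH1Tower ℓ),
      ∀ g : C.G, σ g = (X.rhoEt g).baseChange (AlgebraicClosure ℚ_[ℓ]) :=
    ⟨(Module.End.baseChangeHom ℚ_[ℓ] (AlgebraicClosure ℚ_[ℓ]) (C.etaleH1Tower ℓ)).toMonoidHom.comp X.rhoEt, fun _ => rfl⟩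
  exact fun K => T.exists_ringHom_forall_eigen_toTower_baseChange_mem_span_of_isSemisimpleRing_heckeImage ℓ hI X hX ι ρW σ hσ hD hH K

end S2prime

end Summit.HodgeConjecture.CorCM.HypLiu418

end
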